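import Summits.HodgeConjecture.CorCM.HypLiu418.A3Liu418GSThmD6OneCurve
import Summits.HodgeConjecture.CorCM.HypLiu418.A3Liu418GSFrameDefinite
import Summits.HodgeConjecture.CorCM.HypLiu418.A3Liu418GSFrameChoice
import Summits.HodgeConjecture.CorCM.HypLiu418.A3Liu418GSFaceTransport
import Summits.HodgeConjecture.CorCM.HypLiu418.A3Liu418GSOmegaFaceCast
import Summits.HodgeConjecture.CorCM.HypLiu418.A3Liu418GSCentralPlug
import Summits.HodgeConjecture.CorCM.HypLiu418.A3Liu418GSCentralPlugTail
import Literature.NumberTheory.Automorphic.Liu2021.Def411WeilCarriersFrameTransportHolds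
import Literature.NumberTheory.Automorphic.Liu2021.Def411WeilCarriersDoublingSeesawLine
import Literature.NumberTheory.Automorphic.Liu2021.AppendixC.OmegaHomTransfer
import Literature.NumberTheory.Automorphic.UnitaryGroupFinAdelicCongrCenter
import HarnessLib

/-!
# GS-6 from [Liu2021, Thm. D.6 (1)] for one curve — PIECES module (§1 the head on the package, §2 the transfer from an adapted frame)

PRE-SPLIT (director hodgecm-mathlib s168 (1)(d) ∕ s177 ∕ s178 (3), A-plan1 (g13) 19:14:52Z «every filed piece ≤ 250 check-node
CPU-s»; cutter A-p18 (g10)): A-p17 (g7/g8)՚s report-first `A3Liu418GSFrobeniusOfThmD6` b02ca771e6e9ad41 (349 l., ≈ 390 CPU-s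
synchronous on a check node) is filed as the 3-module chain `A3Liu418GSFrobeniusOfThmD6Pieces` (§1–§2) →
`A3Liu418GSFrobeniusOfThmD6Fold` (§3) → `A3Liu418GSFrobeniusOfThmD6` (§4, the head, module name KEPT for the β registry import);
every declaration (statement, proof, docstring, `set_option … in` line) is BYTE-IDENTICAL to b02ca771, same namespace
`Summit.HodgeConjecture.CorCM.Lines.A3Liu418`, unchanged fully-qualified names; the file-level `open` block is repeated per module.

This module: §1 `frobeniusActsByGS_of_pieces₂` (+ two private plumbing lemmas) and §2 `decompositionAtFace_of_adapted`,
`frobeniusActsByGS_of_pieces₃` — see the head module `A3Liu418GSFrobeniusOfThmD6` for the full description (its docstring is the b02ca771 text).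
THEOREMS ONLY.  HC_CM is proved only modulo the 7 printed citations until rung 0 closes; this file discharges none of them.

## References
* [Liu2021] Y. Liu, *Fourier–Jacobi cycles and arithmetic relative trace formula* (FJcycle.tex), Camb. J. Math. 9 (2021) = arXiv:2102.11518:
  Thm. 4.15 proof p. 51 (l. 2193–2212); §4.2 (l. 2162–2165); App. D: Rem. D.5 p. 131, Thm. D.6 (1) p. 132 (l. 5433–5443).
-/

set_option autoImplicit false

noncomputable section

open scoped TensorProduct Matrix NumberField Kronecker ComplexOrder
open NumberField NumberField.InfinitePlace IsDedekindDomain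
open Summit.HodgeConjecture.CorCM.Model
open Summit.HodgeConjecture.CorCM.Model.HComp Summit.HodgeConjecture.CorCM.HComp
open Literature.AlgebraicGeometry.Motives (CMType)
open Literature.AlgebraicGeometry.ShimuraVarieties.UnitaryCanonicalModel
open Literature.NumberTheory.Automorphic Literature.NumberTheory.Automorphic.UnitaryGroup
open Literature.NumberTheory.Automorphic.IdeleClassGroup
open Literature.NumberTheory.Automorphic.Liu2021 Literature.NumberTheory.Automorphic.Liu2021.AppendixC
open Literature.NumberTheory.GaloisRepresentations
open Literature.AlgebraicGeometry.Liu2021 (IsAdmissibleElement)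
open Literature.RepresentationTheory.Liu2021
open Literature.RepresentationTheory.HarrisKudlaSweet1996
open Literature.NumberTheory.Weil1964
open Literature.NumberTheory.GelbartRogawski1991
open Literature.NumberTheory.GelbartRogawski1991.UnitaryDualPair
open Literature.NumberTheory.GelbartRogawski1991.UnitaryDualPair.WeilCoinv
open Literature.NumberTheory.GelbartRogawski1991.UnitaryDualPair.LocalSplitting
open Literature.NumberTheory.Automorphic.Liu2021.Def411WeilCarriersDoubling
open Literature.NumberTheory.Automorphic.Liu2021.Def411WeilCarriers (TW JW JW_eq isSymm_TW isUnit_det_TW Rep Eps epsOf Chi)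
open Literature.NumberTheory.Automorphic.Liu2021.Def411WeilCarriers (rhoVAtLine)

namespace Summit.HodgeConjecture.CorCM.Lines.A3Liu418

/-! ## §1 The head on the package: the see-saw assembly of [Liu2021, Thm. 4.15 proof l. 2199–2212] -/

/-- `T (g x) = c • g x` on a tensor product from the pure tensors (plumbing). [folklore] -/
private theorem eigen_on_tensor_of_tmul {R : Type*} [CommSemiring R] {A M : Type*} [AddCommMonoid A] [AddCommMonoid M] [Module R A]
    [Module R M] {S : Type*} [Semiring S] {σ : R →+* S} {E : Type*} [AddCommMonoid E] [Module S E]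
    (g : A ⊗[R] M →ₛₗ[σ] E) (T : E →ₗ[S] E) (c : S) (h : ∀ (u : A) (m : M), T (g (u ⊗ₜ m)) = c • g (u ⊗ₜ m)) (x : A ⊗[R] M) :
    T (g x) = c • g x := by
  induction x using TensorProduct.induction_on with
  | zero => simp
  | tmul u m => exact h u m
  | add x y hx hy => rw [map_add, map_add, hx, hy, smul_add]

/-- `(ι₁ a′)⁻¹` is a positive real when `ι₁ a′` is (plumbing for `t := a′⁻¹`). [folklore] -/
private theorem inv_re_pos_im_zero {L : Type} [Field L] (τ : L →+* ℂ) {a : L} (ha : 0 < (τ a).re) (ha' : (τ a).im = 0) :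
    0 < (τ a⁻¹).re ∧ (τ a⁻¹).im = 0 := by
  have hreal : τ a = ((τ a).re : ℂ) := Complex.ext rfl (by rw [Complex.ofReal_im]; exact ha')
  rw [map_inv₀, hreal, ← Complex.ofReal_inv, Complex.ofReal_re, Complex.ofReal_im]
  exact ⟨inv_pos.2 ha, rfl⟩

set_option maxHeartbeats 6400000 in -- measured (1.6 M, 3.2 M] at the 160 k-margin probe (O5 2× envelope)
/-- **`frobeniusActsByGS` from [Liu2021 Thm. D.6 (1)] for the curve (`thmD6OneCurveCUF`) and the package `DecompositionAtFace`.**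
The degenerate sign branch (complement `J⊥` not positive at `ι₁`) is EMPTY — no curve record `S` exists there (`gsFrame_false_of_neg` for
`Re < 0` by the Sylvester count, `gsFrame_re_subformRight_ne_zero` for `Re = 0`, `A3Liu418GSFrameDefinite`); on the printed branch: `Sv`
from `hD6` ONCE at `t := a′⁻¹` (uniform in the labels); for `f′, v, σ, w` joint injectivity of the `P i` reduces to
`P i (σ·(f′ w)) = c • P i (f′ w)`; `P i` commutes past `σ`; `P i ∘ f′ = g ∘ q i`; on `g` the scalar identity holds on pure tensors by `hD6`
applied to the slice `u ↦ g (u ⊗ m)`, hence everywhere (`TensorProduct.induction_on`).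
[cite: Liu2021, Thm. 4.15 proof l. 2193–2212; Thm. D.6 (1) p. 132; Rem. D.5 p. 131] -/
theorem frobeniusActsByGS_of_pieces₂ (hD6 : thmD6OneCurveCUF) (h : DecompositionAtFace) : frobeniusActsByGS := by
  unfold thmD6OneCurveCUF at hD6
  unfold DecompositionAtFace at h
  intro hDel F _ ι₁ V a Φ hΦ ν hν hw ℓ _ ι' Jstar K₀ S hU7ₛ hLQ h4 isoₛ Jperp B a' ha hB hτa hτa' ε hadm χ
  -- the degenerate branch (complement not positive at `ι₁`) is EMPTY: no curve record `S` exists at such a frame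
  -- (`A3Liu418GSFrameDefinite`: `Re < 0` by the Sylvester count, `Re = 0` by non-degeneracy)
  by_cases hpos : 0 < (ι₁ (Jperp 0 0)).re
  swap
  · exfalso
    rcases (not_lt.mp hpos).lt_or_eq with hneg | h0
    · exact gsFrame_false_of_neg
        (⟨HodgeCM.HermSpace3.Hm V, HodgeCM.HermSpace3.isHermitian V, HodgeCM.HermSpace3.signature_ι₁ V, HodgeCM.HermSpace3.posDef_of_ne V⟩ :
          HermSpace3 ⟨HodgeCM.CMField.K F⟩ ι₁) Jstar Jperp B hB hτa hτa' hneg S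
    · exact gsFrame_re_subformRight_ne_zero
        (⟨HodgeCM.HermSpace3.Hm V, HodgeCM.HermSpace3.isHermitian V, HodgeCM.HermSpace3.signature_ι₁ V, HodgeCM.HermSpace3.posDef_of_ne V⟩ :
          HermSpace3 ⟨HodgeCM.CMField.K F⟩ ι₁) Jstar Jperp B ha hB hτa' h0
  obtain ⟨gstar, dJ, hdJ, hdJ0, hg, hsig, r, I, P, hPinj, hPT, εc, χc, hadmc, M, q, hfac⟩ :=
    h hDel F V a Φ hΦ ν hν hw ℓ ι' Jstar K₀ S hU7ₛ hLQ h4 isoₛ Jperp B a' ha hB hτa hτa' hpos ε hadm χ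
  -- the hoisted fact ONCE, at `t := a′⁻¹`
  obtain ⟨hτt, hτt'⟩ := inv_re_pos_im_zero ι₁ hτa hτa'
  obtain ⟨Sv, hSvfin, hSv⟩ := hD6 ⟨HodgeCM.CMField.K F⟩ ν hν hw ℓ ι' Jstar a'⁻¹ (inv_ne_zero ha) hτt hτt' gstar dJ hdJ hdJ0 hg hsig
    K₀ S hU7ₛ hLQ h4 isoₛ r
  refine ⟨Sv, hSvfin, ?_⟩
  intro v hv 𝔓 h𝔓 σ hσ f' hf' w
  -- joint injectivity of the projectors
  rw [← sub_eq_zero]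
  refine hPinj _ fun i => ?_
  obtain ⟨g, hg', hgmem⟩ := hfac i f' hf'
  rw [map_sub, map_smul, hPT, hg', sub_eq_zero]
  -- the scalar identity on `g`, from the slices
  exact eigen_on_tensor_of_tmul g _ _ (fun u m => hSv (εc i) (hadmc i) (χc i) v hv 𝔓 h𝔓 σ hσ _ (hgmem m) u) (q i w)

/-! ## §2 The transfer from an adapted frame -/

section Adapted

open HodgeCM.Model HodgeCM.Model.LiuIndex
open Literature.NumberTheory.Automorphic.Liu2021.Def411WeilCarriers (lineOf locF)
open Summit.HodgeConjecture.CorCM.Transposition.OmegaTransport (realUnit)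
open HodgeCM.Model.ArchSideTerm (e₁)
open Summit.HodgeConjecture.CorCM.D2Bridge.AdapterMuConj (muConj)

set_option maxHeartbeats 6400000 in -- measured (1.6 M, 3.2 M] at the 160 k-margin probe (O5 2× envelope)
/-- **THE TRANSFER**: the adapted package gives the package of record — same frame
data, Weil data, projectors, labels and multiplicity modules; `q i := q i ∘ Ψ`; every `f′ ∈ Hom_𝔾(ι′∘(ω_face∘φGS), H¹)` is pulled to
`f′ ∘ Ψ⁻¹ ∈ Hom_𝔾(ι′∘(ω_{D′}∘φGS), H¹)` (equivariance of `Ψ⁻¹`), factorised there, and read back at `Ψ w`.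
[cite: Liu2021, Thm. 4.15 proof l. 2199–2212] -/
theorem decompositionAtFace_of_adapted (h : DecompositionAtFaceAdapted) : DecompositionAtFace := by
  intro hDel F _ ι₁ V a Φ hΦ ν hν hw ℓ _ ι' Jstar K₀ S hU7ₛ hLQ h4 isoₛ Jperp B a' ha hB hτa hτa' hpos ε hadm χ
  obtain ⟨gstar, dJ, hdJ, hdJ0, hg, hsig, dV, hdV, hdV0, ιV, ε', χ', Ψ, hΨ, r, I, P, hPinj, hPT, εc, χc, hadmc, M, q, hfac⟩ :=
    h hDel F V a Φ hΦ ν hν hw ℓ ι' Jstar K₀ S hU7ₛ hLQ h4 isoₛ Jperp B a' ha hB hτa hτa' hpos ε hadm χ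
  refine ⟨gstar, dJ, hdJ, hdJ0, hg, hsig, r, I, P, hPinj, hPT, εc, χc, hadmc, M, fun i => (q i).comp Ψ.toLinearMap, ?_⟩
  intro i f' hf'
  -- `Ψ⁻¹` intertwines `ω_{D′}` with `ω_face`
  have hΨ' : ∀ (g : (CV hDel F V Φ).G) (x : (UVat hDel F V a Φ dV hdV hdV0 ιV).omega ν hν ε' χ'),
      Ψ.symm ((UVat hDel F V a Φ dV hdV hdV0 ιV).rho ν hν ε' χ' g x) = (UV hDel F V a Φ).rho ν hν ε χ g (Ψ.symm x) := by
    intro g x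
    rw [LinearEquiv.symm_apply_eq, hΨ, LinearEquiv.apply_symm_apply]
  obtain ⟨g, hg', hgmem⟩ := hfac i (f'.comp Ψ.symm.toLinearMap)
    (Sec42Data.EtaleHeckeDatum.comp_mem_omegaHom _ ι' _ _ Ψ.symm.toLinearMap
      (fun g x => hΨ' (φGS (F : Type) Jstar Jperp (HodgeCM.HermSpace3.Hm V) B ha hB g) x) hf')
  refine ⟨g, fun w => ?_, hgmem⟩
  have hw := hg' (Ψ w)
  simpa only [LinearMap.comp_apply, LinearEquiv.coe_toLinearMap, LinearEquiv.symm_apply_apply] using hw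

/-- **`frobeniusActsByGS` from the named fact and the ADAPTED package** (degenerate branch discharged, transfer through `Ψ`).
[cite: Liu2021, Thm. 4.15 proof l. 2199–2212; Thm. D.6 (1) p. 132] -/
theorem frobeniusActsByGS_of_pieces₃ (hD6 : thmD6OneCurveCUF) (h : DecompositionAtFaceAdapted) : frobeniusActsByGS :=
  frobeniusActsByGS_of_pieces₂ hD6 (decompositionAtFace_of_adapted h)

end Adapted

end Summit.HodgeConjecture.CorCM.Lines.A3Liu418

end
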